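import Mathlib.Algebra.Module.Torsion.Basic
import Mathlib.RingTheory.Coprime.Lemmas
import Mathlib.Data.Int.GCD
import Mathlib.GroupTheory.OrderOfElement
import HarnessLib

/-!
# Two elementary "no fixed point" lemmas for the TAME MIRACLE (helper for cruxes `GordTwoRankZeroOffCaseOne` stmt-BirchSwinnertonDyer-19357 /
# `MultLower` stmt-19359, lines `three_field_road` / `tame_roads_mult` v20, stub `stub_tameLocalVanishing{R0,M}`)

Lead seat cruxlead-19357 (gen 6). The registered stub asks that `E_K[p^∞]` have no non-zero point fixed by the inertia group of the
`ℤ_p²`-tower at `𝔭′`; the recipe (LeadReport13 §5) ends with: pick `σ` in that inertia group acting on the line `Fil ⊆ E[p]` by a scalar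
`c` with `p ∤ c − 1` and on `E[p]/Fil` by `−1`; then `E[p]^σ = 0`, hence `E[p^∞]^σ = 0`. This file proves exactly these two closing steps
for an arbitrary additive group with a distributive action (no elliptic curve, no Galois group):

* `fixed_eq_zero_of_filtration` — `M` killed by the odd prime `p`, `F ≤ M` with `σ f = c • f` on `F` (`p ∤ c − 1`, `c : ℕ`) and
  `σ m + m ∈ F` for all `m` (i.e. `σ = −1` on `M/F`): every `σ`-fixed `m` is `0`.
* `fixed_eq_zero_of_pPrimary` — `M` `p`-primary (`∀ m, ∃ k, p^k • m = 0`) and `σ` without non-zero fixed point on `M[p]`: `σ` has no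
  non-zero fixed point on `M`.

Pure algebra; no definition, no named fact, no `sorry`. BSD is not proved by any of this.
References: Serre, Invent. Math. 15 (1972) §1.11 (the shape of `E[p]|_{I_p}` at an ordinary prime); folklore.
-/

-- D-0017: single-problem summit, the namespace repeats the problem name by design.
set_option linter.dupNamespace false
set_option autoImplicit false

namespace Summit.BirchSwinnertonDyer.BirchSwinnertonDyer.Theorems.TameNoFixedPoints

variable {G : Type*} [Monoid G] {M : Type*} [AddCommGroup M] [DistribMulAction G M]

/-- **No fixed vector from a two-step filtration** (`p` odd prime): if `p • M = 0`, `F ≤ M` is a subgroup on which `σ` acts by the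
natural number `c` with `p ∤ c − 1` (as an integer), and `σ m + m ∈ F` for every `m` (so `σ = −1` on `M/F`), then `σ m = m ⟹ m = 0`:
`2m = σ m + m ∈ F`, `p` odd gives `m ∈ F`, then `(c − 1) • m = 0` with `p ∤ c − 1` and `p • m = 0` gives `m = 0`. [folklore] -/
theorem fixed_eq_zero_of_filtration {p : ℕ} (hp : p.Prime) (hp2 : p ≠ 2) (hM : ∀ m : M, p • m = 0)
    (F : AddSubgroup M) (σ : G) (c : ℕ) (hF : ∀ f ∈ F, σ • f = c • f) (hc : ¬ (p : ℤ) ∣ (c : ℤ) - 1)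
    (hquot : ∀ m : M, σ • m + m ∈ F) {m : M} (hm : σ • m = m) : m = 0 := by
  -- `2 • m ∈ F`, hence `m ∈ F` (`2` is invertible modulo the odd prime `p`)
  have h2m : (2 : ℕ) • m ∈ F := by
    have := hquot m
    rwa [hm, ← two_nsmul] at this
  have hcop : Nat.Coprime 2 p := (Nat.coprime_primes Nat.prime_two hp).2 (Ne.symm hp2)
  have hmF : m ∈ F := by
    obtain ⟨u, -, hu⟩ := Nat.exists_mul_mod_eq_one_of_coprime hcop hp.one_lt
    have e : (2 * u) • m = m := by
      have hdm := Nat.div_add_mod (2 * u) p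
      rw [hu] at hdm
      calc (2 * u) • m = (p * (2 * u / p) + 1) • m := by rw [hdm]
        _ = (2 * u / p) • (p • m) + m := by rw [add_nsmul, one_nsmul, mul_comm, mul_nsmul']
        _ = m := by rw [hM, smul_zero, zero_add]
    rw [← e, mul_comm, mul_nsmul']
    exact F.nsmul_mem h2m u
  -- on `F`, `σ` acts by `c`: `(c - 1) • m = 0` in the `ℤ`-module `M`
  have hcm : ((c : ℤ) - 1) • m = 0 := by
    rw [sub_smul, one_smul, natCast_zsmul, ← hF m hmF, hm, sub_self]
  have hpm : (p : ℤ) • m = 0 := by rw [natCast_zsmul]; exact hM m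
  -- Bézout: `a (c-1) + b p = 1`
  have hcopz : IsCoprime ((c : ℤ) - 1) (p : ℤ) := by
    rw [Int.isCoprime_iff_gcd_eq_one]
    have hdvd := Int.gcd_dvd_right ((c : ℤ) - 1) (p : ℤ)
    have hprime : Nat.Prime p := hp
    rcases (Nat.dvd_prime hprime).1 (by exact_mod_cast hdvd : Int.gcd ((c : ℤ) - 1) p ∣ p) with h1 | hpp
    · exact h1
    · exfalso
      apply hc
      have := Int.gcd_dvd_left ((c : ℤ) - 1) (p : ℤ)
      rw [hpp] at this
      exact this
  obtain ⟨a, b, hab⟩ := hcopz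
  calc m = (1 : ℤ) • m := (one_smul ℤ m).symm
    _ = (a * ((c : ℤ) - 1) + b * p) • m := by rw [hab]
    _ = a • (((c : ℤ) - 1) • m) + b • ((p : ℤ) • m) := by rw [add_smul, mul_smul, mul_smul]
    _ = 0 := by rw [hcm, hpm, smul_zero, smul_zero, add_zero]

/-- **`p`-primary lifting**: if every element of `M` is killed by a power of `p` and `σ` fixes no non-zero element of `M[p]`, then `σ`
fixes no non-zero element of `M` (a fixed `x` of order `p^n`, `n ≥ 1`, yields the fixed `p^{n-1} • x ≠ 0` of order `p`). [folklore] -/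
theorem fixed_eq_zero_of_pPrimary {p : ℕ} (htor : ∀ m : M, ∃ k : ℕ, p ^ k • m = 0) (σ : G)
    (hσ : ∀ y : M, p • y = 0 → σ • y = y → y = 0) {x : M} (hx : σ • x = x) : x = 0 := by
  classical
  obtain ⟨k, hk⟩ := htor x
  -- the least `k` with `p^k • x = 0`
  induction k using Nat.strong_induction_on generalizing x with
  | _ k ih =>
    by_cases hk0 : k = 0
    · subst hk0; simpa using hk
    obtain ⟨n, rfl⟩ := Nat.exists_eq_succ_of_ne_zero hk0
    -- `y = p^n • x` is killed by `p` and fixed by `σ`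
    have hy0 : p • (p ^ n • x) = 0 := by
      rw [← mul_nsmul', ← pow_succ']
      exact hk
    have hyσ : σ • (p ^ n • x) = p ^ n • x := by
      have h := (DistribSMul.toAddMonoidHom M σ).map_nsmul (p ^ n) x
      simp only [DistribSMul.toAddMonoidHom_apply] at h
      rw [h, hx]
    have hy : p ^ n • x = 0 := hσ _ hy0 hyσ
    exact ih n (Nat.lt_succ_self n) hx hy

end Summit.BirchSwinnertonDyer.BirchSwinnertonDyer.Theorems.TameNoFixedPoints
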